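import Summits.QuantumFields.YangMills.Theorems.SoloInformedAnatomy
import Literature.MathematicalPhysics.QuantumFieldTheory.LatticeGaugeProofs
import HarnessLib
import HarnessLib.Audit.Tags

/-!
# QuantumFields / YangMills — the two-scale handover shape of the lattice core (solo seat `solo-QuantumFields-informed`)

Kernel bookkeeping for the seat's "crossover reduction" of the lattice core `WeakCouplingLatticeGap`
(`SoloInformedAnatomy`): exponential clustering of the Wilson measure at large `β` is split along a
two-scale presentation `μ_{Λ,β} = κ ∘ₘ ν` (a coarse probability space `(Y, ν)` and a Markov kernel `κ` of
conditional fine-scale laws) by the **law of total covariance**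

  `⟨fg⟩_μ − ⟨f⟩_μ⟨g⟩_μ = ∫ (⟨fg⟩_{κy} − ⟨f⟩_{κy}⟨g⟩_{κy}) dν(y) + (⟨κf·κg⟩_ν − ⟨κf⟩_ν⟨κg⟩_ν)`

(`connCorr_comp`), so that clustering of `μ` follows from (H1) clustering of the conditional laws `κ y` on
`ν`-average ("fluctuation" term) and (H2) clustering of the coarse law `ν` for the block observables
`κf = ∫ f dκ(·)` ("effective" term), with rate the minimum and amplitude the sum (`abs_connCorr_comp_le`,
`latticeClustering_of_handover`). Closed form: the data record `HandoverWitness G` ((H1) ∧ (H2) along SOME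
family of presentations) and the PROVED equivalence `handoverWitness_iff_weakCouplingLatticeGap : (∀ compact
simple G, Nonempty (HandoverWitness G)) ↔ WeakCouplingLatticeGap` — a reformulation of the existing lattice-core
node, registering no new conjecture.

WHAT THIS DOES AND DOES NOT SAY. The identity holds for EVERY disintegration, and for the two cheap ones it
moves nothing (the `←` direction records the first in the kernel): for the trivial presentation
(`Handover.trivial`) term (H2) vanishes and (H1) is the whole claim; for the DLR/Markov presentation (`ν` = law
of the links on a separating corridor set, `κ y` = product of cell Gibbs measures) term (H1) vanishes for
observables in different cells and (H2) is a restatement. The presentation that carries content is Bałaban's block-AVERAGE disintegration after `n(β)`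
renormalisation steps (`ν` = law of the block-averaged field with its effective action at a `β`-INDEPENDENT
small effective coupling `γ`, `κ` = the conditional fluctuation integral): there (H1) is the small-field/large-
field output of the ultraviolet-stability programme (asymptotic freedom's job; in print only conditionally on the
coupling flow staying in `]0, γ]` — Bałaban, CMP 109 (1987) Thm. 1 p. 259 and CMP 122 (1989) Thm. 1 p. 355, the
flow itself being Thm. 2 of CMP 109, stated with proof deferred — and not in the volume-uniform clustering form) and
(H2) is volume-uniform exponential clustering of a `β`-INDEPENDENT compact class of unit-lattice effective
actions (confinement's job; open — the final unit-lattice cluster expansion is deferred to "another paper"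
already for the abelian Higgs model, Bałaban–Imbrie–Jaffe CMP 114 (1988) p. 258). None of that analysis is
formalised here: `Handover` is an abstract structure and the theorems are measure-theoretic logic. The file
records the typed place where the two halves of the problem meet; see the seat's PLAN.md §4 (P3).

No facts, no axioms, no `sorry`.
-/

open MeasureTheory ProbabilityTheory Filter Topology
open Literature.MathematicalPhysics.AQFT Literature.MathematicalPhysics.QuantumLattice
open Literature.MathematicalPhysics.QuantumFieldTheory Literature.Probability.LatticeModels

noncomputable section

namespace Summit.QuantumFields.YangMills.Theorems

/-! ### Connected correlations and the law of total covariance -/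

section TotalCovariance

variable {X Y : Type*} [MeasurableSpace X] [MeasurableSpace Y]

/-- The connected correlation (covariance in un-centred form) `⟨fg⟩_μ − ⟨f⟩_μ⟨g⟩_μ` of two real
observables — the shape of the tree's `latticeConnectedCorr`. -/
def connCorr (μ : Measure X) (f g : X → ℝ) : ℝ :=
  (∫ x, f x * g x ∂μ) - (∫ x, f x ∂μ) * ∫ x, g x ∂μ

/-- The block observable `κf : y ↦ ∫ f dκ(y)` of `f` under the kernel `κ`. -/
def blockObs (κ : Kernel Y X) (f : X → ℝ) : Y → ℝ := fun y => ∫ x, f x ∂(κ y)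

/-- Bochner integral against a measure–kernel composition: `∫ f d(κ ∘ₘ ν) = ∫ (∫ f dκ(y)) dν(y)`. -/
theorem integral_comp_eq_integral_blockObs {ν : Measure Y} {κ : Kernel Y X} {f : X → ℝ}
    (hf : Integrable f (κ ∘ₘ ν)) : ∫ x, f x ∂(κ ∘ₘ ν) = ∫ y, blockObs κ f y ∂ν := by
  rw [Measure.comp_eq_comp_const_apply] at hf ⊢
  rw [Kernel.integral_comp hf, Kernel.const_apply]
  simp only [blockObs]

/-- Integrability of the block observable of an integrable observable. -/
theorem integrable_blockObs {ν : Measure Y} {κ : Kernel Y X} {f : X → ℝ}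
    (hf : Integrable f (κ ∘ₘ ν)) : Integrable (blockObs κ f) ν := by
  rw [Measure.comp_eq_comp_const_apply] at hf
  have h := hf.integral_comp
  rw [Kernel.const_apply] at h
  exact h

/-- **Law of total covariance** (un-centred form) for a measure–kernel composition `κ ∘ₘ ν`:
`Cov_{κ∘ν}(f,g) = ∫ Cov_{κy}(f,g) dν(y) + Cov_ν(κf, κg)`, under the four integrability conditions that
make every term meaningful. -/
theorem connCorr_comp {ν : Measure Y} {κ : Kernel Y X} {f g : X → ℝ}
    (hf : Integrable f (κ ∘ₘ ν)) (hg : Integrable g (κ ∘ₘ ν))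
    (hfg : Integrable (fun x => f x * g x) (κ ∘ₘ ν))
    (hκ : Integrable (fun y => blockObs κ f y * blockObs κ g y) ν) :
    connCorr (κ ∘ₘ ν) f g =
      (∫ y, connCorr (κ y) f g ∂ν) + connCorr ν (blockObs κ f) (blockObs κ g) := by
  have hfg' : Integrable (blockObs κ (fun x => f x * g x)) ν := integrable_blockObs hfg
  have hsplit : (∫ y, connCorr (κ y) f g ∂ν) =
      (∫ y, blockObs κ (fun x => f x * g x) y ∂ν) - ∫ y, blockObs κ f y * blockObs κ g y ∂ν := by
    rw [← integral_sub hfg' hκ]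
    rfl
  rw [hsplit]
  unfold connCorr
  rw [integral_comp_eq_integral_blockObs hf, integral_comp_eq_integral_blockObs hg,
    integral_comp_eq_integral_blockObs hfg]
  simp only [blockObs]
  ring

/-- A bounded measurable real observable is integrable for every finite measure. -/
theorem integrable_of_abs_le {μ : Measure X} [IsFiniteMeasure μ] {f : X → ℝ} (hfm : Measurable f)
    {C : ℝ} (hf : ∀ x, |f x| ≤ C) : Integrable f μ :=
  (integrable_const C).mono' hfm.aestronglyMeasurable
    (ae_of_all _ fun x => by simpa [Real.norm_eq_abs] using hf x)

/-- The block observable of a bounded observable under a Markov kernel obeys the same bound. -/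
theorem abs_blockObs_le {κ : Kernel Y X} [IsMarkovKernel κ] {f : X → ℝ} {C : ℝ}
    (hf : ∀ x, |f x| ≤ C) (y : Y) : |blockObs κ f y| ≤ C := by
  have h := norm_integral_le_of_norm_le_const (μ := κ y) (f := f) (C := C)
    (ae_of_all _ fun x => by simpa [Real.norm_eq_abs] using hf x)
  simp only [blockObs]
  simpa [Real.norm_eq_abs] using h

/-- **Law of total covariance for bounded measurable observables** (finite `ν`, Markov `κ`): the four
integrability conditions of `connCorr_comp` hold automatically. -/
theorem connCorr_comp_of_bounded {ν : Measure Y} [IsFiniteMeasure ν] {κ : Kernel Y X}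
    [IsMarkovKernel κ] {f g : X → ℝ} (hfm : Measurable f) (hgm : Measurable g) {Cf Cg : ℝ}
    (hf : ∀ x, |f x| ≤ Cf) (hg : ∀ x, |g x| ≤ Cg) :
    connCorr (κ ∘ₘ ν) f g =
      (∫ y, connCorr (κ y) f g ∂ν) + connCorr ν (blockObs κ f) (blockObs κ g) := by
  have hfi : Integrable f (κ ∘ₘ ν) := integrable_of_abs_le hfm hf
  have hgi : Integrable g (κ ∘ₘ ν) := integrable_of_abs_le hgm hg
  have hfgi : Integrable (fun x => f x * g x) (κ ∘ₘ ν) :=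
    hgi.bdd_mul hfm.aestronglyMeasurable
      (ae_of_all _ fun x => by simpa [Real.norm_eq_abs] using hf x)
  have hκ : Integrable (fun y => blockObs κ f y * blockObs κ g y) ν :=
    (integrable_blockObs hgi).bdd_mul (integrable_blockObs hfi).aestronglyMeasurable
      (ae_of_all _ fun y => by simpa [Real.norm_eq_abs] using abs_blockObs_le (κ := κ) hf y)
  exact connCorr_comp hfi hgi hfgi hκ

/-- **Clustering composes through scales**: `|Cov_{κ∘ν}(f,g)| ≤ ∫ |Cov_{κy}(f,g)| dν(y) + |Cov_ν(κf,κg)|`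
for bounded measurable `f, g`. -/
theorem abs_connCorr_comp_le {ν : Measure Y} [IsFiniteMeasure ν] {κ : Kernel Y X} [IsMarkovKernel κ]
    {f g : X → ℝ} (hfm : Measurable f) (hgm : Measurable g) {Cf Cg : ℝ} (hf : ∀ x, |f x| ≤ Cf)
    (hg : ∀ x, |g x| ≤ Cg) :
    |connCorr (κ ∘ₘ ν) f g| ≤
      (∫ y, |connCorr (κ y) f g| ∂ν) + |connCorr ν (blockObs κ f) (blockObs κ g)| := by
  rw [connCorr_comp_of_bounded hfm hgm hf hg]
  exact (abs_add_le _ _).trans (by gcongr; exact abs_integral_le_integral_abs)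

/-- **Two exponential bounds combine** at the smaller rate with the summed (non-negative) amplitudes. -/
theorem exp_bound_add {x t₁ t₂ C₁ C₂ m₁ m₂ s : ℝ} (hs : 0 ≤ s) (h₁ : t₁ ≤ C₁ * Real.exp (-(m₁ * s)))
    (h₂ : t₂ ≤ C₂ * Real.exp (-(m₂ * s))) (hx : x ≤ t₁ + t₂) :
    x ≤ (max C₁ 0 + max C₂ 0) * Real.exp (-(min m₁ m₂ * s)) := by
  have e₁ : Real.exp (-(m₁ * s)) ≤ Real.exp (-(min m₁ m₂ * s)) :=
    Real.exp_le_exp.mpr (by nlinarith [min_le_left m₁ m₂])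
  have e₂ : Real.exp (-(m₂ * s)) ≤ Real.exp (-(min m₁ m₂ * s)) :=
    Real.exp_le_exp.mpr (by nlinarith [min_le_right m₁ m₂])
  have h₁' : t₁ ≤ max C₁ 0 * Real.exp (-(min m₁ m₂ * s)) :=
    h₁.trans ((mul_le_mul_of_nonneg_right (le_max_left _ _) (Real.exp_nonneg _)).trans
      (mul_le_mul_of_nonneg_left e₁ (le_max_right _ _)))
  have h₂' : t₂ ≤ max C₂ 0 * Real.exp (-(min m₁ m₂ * s)) :=
    h₂.trans ((mul_le_mul_of_nonneg_right (le_max_left _ _) (Real.exp_nonneg _)).trans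
      (mul_le_mul_of_nonneg_left e₂ (le_max_right _ _)))
  linarith

end TotalCovariance

/-! ### Two-scale presentations of the Wilson measure and the handover reduction -/

section Handover

variable {G : Type} [Group G] [MeasurableSpace G] [TopologicalSpace G] [IsTopologicalGroup G]
  [CompactSpace G] [BorelSpace G]

/-- A **two-scale presentation ("handover")** of Wilson's lattice Yang–Mills measure in the representation
`ρ` at coupling `β` on the torus of side `S`: a coarse probability space `(Y, ν)` and a Markov kernel `κ`
of conditional fine-scale laws with `κ ∘ₘ ν = μ_{Λ_S, β}`. ABSTRACT: every disintegration of the Wilson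
measure qualifies (the trivial one, the DLR/Markov one, Bałaban's block-average one); which one is chosen is
where all the analysis lives (module docstring). -/
structure Handover {N : ℕ} (ρ : G →* Matrix (Fin N) (Fin N) ℂ) (β : ℝ) (S : ℕ) [NeZero S] where
  /-- the coarse ("block", "effective") configuration space -/
  Y : Type
  /-- its σ-algebra -/
  mY : MeasurableSpace Y
  /-- the coarse (effective) law -/
  ν : Measure Y
  isProb : IsProbabilityMeasure ν
  /-- the conditional fine-scale laws -/
  κ : Kernel Y (GaugeConfig 4 S G)
  isMarkov : IsMarkovKernel κ
  /-- the presentation reassembles the Wilson measure -/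
  comp_eq : κ ∘ₘ ν = wilsonMeasure (d := 4) (L := S) ρ β

attribute [instance] Handover.mY Handover.isProb Handover.isMarkov

/-- A gauge-invariant local observable of `ℤ⁴` read on the torus of side `S` through the periodic lift. -/
def torusObs (S : ℕ) (A : YMSpecies G) : GaugeConfig 4 S G → ℝ := fun U => A.F (torusLift S U)

/-- The same, translated by `n` lattice units in Euclidean time (the tree's convention in
`latticeConnectedCorr`). -/
def torusObsShift (S : ℕ) (B : YMSpecies G) (n : ℕ) : GaugeConfig 4 S G → ℝ := fun U =>
  B.F (Literature.MathematicalPhysics.QuantumLattice.configShift (-Pi.single 0 (n : ℤ)) (torusLift S U))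

omit [TopologicalSpace G] [IsTopologicalGroup G] [CompactSpace G] [BorelSpace G] in
/-- Torus observables of a species are measurable. -/
theorem measurable_torusObs (S : ℕ) (A : YMSpecies G) : Measurable (torusObs S A) :=
  A.measurable.comp (measurable_torusLift (d := 4) S)

omit [TopologicalSpace G] [IsTopologicalGroup G] [CompactSpace G] [BorelSpace G] in
/-- Translated torus observables of a species are measurable. -/
theorem measurable_torusObsShift (S : ℕ) (B : YMSpecies G) (n : ℕ) :
    Measurable (torusObsShift S B n) :=
  B.measurable.comp ((MeasurableEquiv.measurable _).comp (measurable_torusLift (d := 4) S))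

omit [TopologicalSpace G] [IsTopologicalGroup G] [CompactSpace G] [BorelSpace G] in
/-- Torus observables of a species inherit its bound. -/
theorem abs_torusObs_le (S : ℕ) (A : YMSpecies G) : ∀ U, |torusObs S A U| ≤ A.bounded.choose :=
  fun U => A.bounded.choose_spec (torusLift S U)

omit [TopologicalSpace G] [IsTopologicalGroup G] [CompactSpace G] [BorelSpace G] in
/-- Translated torus observables of a species inherit its bound. -/
theorem abs_torusObsShift_le (S : ℕ) (B : YMSpecies G) (n : ℕ) :
    ∀ U, |torusObsShift S B n U| ≤ B.bounded.choose :=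
  fun _ => B.bounded.choose_spec _

/-- Translation invariance of the torus Wilson state: the translated observable has the same mean (the tree's
`wilsonExpectation_comp_torusConfigShift` and `toTorusObservable_comp_configShift`). -/
theorem integral_torusObsShift_eq {N : ℕ} (ρ : G →* Matrix (Fin N) (Fin N) ℂ) (β : ℝ) (S : ℕ) [NeZero S]
    (B : YMSpecies G) (n : ℕ) :
    ∫ U, torusObsShift S B n U ∂(wilsonMeasure (d := 4) (L := S) ρ β) =
      ∫ U, torusObs S B U ∂(wilsonMeasure (d := 4) (L := S) ρ β) := by
  have h := wilsonExpectation_comp_torusConfigShift (d := 4) (L := S) (G := G) ρ β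
    (Literature.Probability.LatticeModels.Torus.proj S (-Pi.single 0 (n : ℤ))) (toTorusObservable S B.F)
  rw [← toTorusObservable_comp_configShift] at h
  simpa [wilsonExpectation, toTorusObservable, torusObsShift, torusObs] using h

/-- The tree's connected time-correlation on the torus (which subtracts the UNtranslated means) is `connCorr`
of the Wilson measure for the observable and the translated observable. -/
theorem latticeConnectedCorr_eq_connCorr {N : ℕ} (ρ : G →* Matrix (Fin N) (Fin N) ℂ) (β : ℝ) (S : ℕ)
    [NeZero S] (A B : YMSpecies G) (n : ℕ) :
    latticeConnectedCorr ρ β S A.F B.F n =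
      connCorr (wilsonMeasure (d := 4) (L := S) ρ β) (torusObs S A) (torusObsShift S B n) := by
  unfold connCorr
  rw [integral_torusObsShift_eq]
  simp only [latticeConnectedCorr, torusObs, torusObsShift]

/-- **Handover bound for one correlation.** Along any two-scale presentation `H` of `μ_{Λ_S,β}`, the
connected correlation of `A` and the time-`n` translate of `B` is bounded by the `ν`-averaged conditional
("fluctuation") covariance plus the coarse ("effective") covariance of the block observables. -/
theorem abs_latticeConnectedCorr_le_of_handover {N : ℕ} {ρ : G →* Matrix (Fin N) (Fin N) ℂ} {β : ℝ}
    {S : ℕ} [NeZero S] (H : Handover ρ β S) (A B : YMSpecies G) (n : ℕ) :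
    |latticeConnectedCorr ρ β S A.F B.F n| ≤
      (∫ y, |connCorr (H.κ y) (torusObs S A) (torusObsShift S B n)| ∂H.ν) +
        |connCorr H.ν (blockObs H.κ (torusObs S A)) (blockObs H.κ (torusObsShift S B n))| := by
  rw [latticeConnectedCorr_eq_connCorr, ← H.comp_eq]
  exact abs_connCorr_comp_le (measurable_torusObs S A) (measurable_torusObsShift S B n)
    (abs_torusObs_le S A) (abs_torusObsShift_le S B n)

/-- **Handover reduction of the lattice clustering clause.** (H1) fluctuation clustering (the `ν`-averaged
conditional covariance decays at rate `μ₁ k`) and (H2) effective clustering (the coarse law clusters for the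
block observables at rate `μ₂ k`) along any family of two-scale presentations `H k S` of `μ_{Λ_{2S+1}, β_k}`,
uniformly in the volume `S ≥ L k` and in `n ≤ S` with pair-dependent `k`-independent amplitudes, give the
clustering clause of `WeakCouplingLatticeGap` / `HasLatticeMassGap` for the pair `(A, B)` at rate
`min (μ₁ k) (μ₂ k)`. -/
theorem latticeClustering_of_handover {N : ℕ} {ρ : G →* Matrix (Fin N) (Fin N) ℂ} {β : ℕ → ℝ}
    (H : ∀ k S : ℕ, Handover ρ (β k) (2 * S + 1)) (L : ℕ → ℕ) (μ₁ μ₂ : ℕ → ℝ) (A B : YMSpecies G)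
    (h₁ : ∃ C₁ : ℝ, ∀ᶠ k in atTop, ∀ S : ℕ, L k ≤ S → ∀ n : ℕ, n ≤ S →
      (∫ y, |connCorr ((H k S).κ y) (torusObs (2 * S + 1) A) (torusObsShift (2 * S + 1) B n)| ∂(H k S).ν)
        ≤ C₁ * Real.exp (-(μ₁ k * n)))
    (h₂ : ∃ C₂ : ℝ, ∀ᶠ k in atTop, ∀ S : ℕ, L k ≤ S → ∀ n : ℕ, n ≤ S →
      |connCorr (H k S).ν (blockObs (H k S).κ (torusObs (2 * S + 1) A))
          (blockObs (H k S).κ (torusObsShift (2 * S + 1) B n))| ≤ C₂ * Real.exp (-(μ₂ k * n))) :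
    ∃ C : ℝ, ∀ᶠ k in atTop, ∀ S : ℕ, L k ≤ S → ∀ n : ℕ, n ≤ S →
      |latticeConnectedCorr ρ (β k) (2 * S + 1) A.F B.F n| ≤
        C * Real.exp (-(min (μ₁ k) (μ₂ k) * n)) := by
  obtain ⟨C₁, h₁⟩ := h₁
  obtain ⟨C₂, h₂⟩ := h₂
  refine ⟨max C₁ 0 + max C₂ 0, ?_⟩
  filter_upwards [h₁, h₂] with k hk₁ hk₂ S hS n hn
  exact exp_bound_add (Nat.cast_nonneg n) (hk₁ S hS n hn) (hk₂ S hS n hn)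
    (abs_latticeConnectedCorr_le_of_handover (H k S) A B n)

/-- The **trivial presentation** of a probability measure: one coarse point, the kernel constantly `μ`. Witness
that (H1) ∧ (H2) over ALL presentations has no more content than clustering itself
(`handoverWitness_iff_weakCouplingLatticeGap`, direction `←`). -/
def Handover.trivial {N : ℕ} (ρ : G →* Matrix (Fin N) (Fin N) ℂ) (hρ : Continuous ρ) (β : ℝ) (S : ℕ)
    [NeZero S] : Handover ρ β S :=
  haveI := isProbabilityMeasure_wilsonMeasure (d := 4) (L := S) (G := G) ρ hρ β
  { Y := Unit
    mY := inferInstance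
    ν := Measure.dirac ()
    isProb := inferInstance
    κ := Kernel.const Unit (wilsonMeasure (d := 4) (L := S) ρ β)
    isMarkov := inferInstance
    comp_eq := by rw [Measure.const_comp]; simp }

/-- Along the trivial presentation the fluctuation term (H1) IS the full connected correlation. -/
theorem Handover.trivial_fluctuation {N : ℕ} (ρ : G →* Matrix (Fin N) (Fin N) ℂ) (hρ : Continuous ρ) (β : ℝ)
    (S : ℕ) [NeZero S] (f g : GaugeConfig 4 S G → ℝ) :
    (∫ y, |connCorr ((Handover.trivial ρ hρ β S).κ y) f g| ∂(Handover.trivial ρ hρ β S).ν) =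
      |connCorr (wilsonMeasure (d := 4) (L := S) ρ β) f g| := by
  change ∫ y : Unit, |connCorr ((Kernel.const Unit (wilsonMeasure (d := 4) (L := S) ρ β)) y) f g|
      ∂(Measure.dirac ()) = _
  rw [integral_dirac, Kernel.const_apply]

/-- Along the trivial presentation the effective term (H2) vanishes identically. -/
theorem Handover.trivial_effective {N : ℕ} (ρ : G →* Matrix (Fin N) (Fin N) ℂ) (hρ : Continuous ρ) (β : ℝ)
    (S : ℕ) [NeZero S] (f g : GaugeConfig 4 S G → ℝ) :
    connCorr (Handover.trivial ρ hρ β S).ν (blockObs (Handover.trivial ρ hρ β S).κ f)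
      (blockObs (Handover.trivial ρ hρ β S).κ g) = 0 := by
  change connCorr (Measure.dirac ())
      (blockObs (Kernel.const Unit (wilsonMeasure (d := 4) (L := S) ρ β)) f)
      (blockObs (Kernel.const Unit (wilsonMeasure (d := 4) (L := S) ρ β)) g) = 0
  simp [connCorr, blockObs]

end Handover

/-! ### The closed form -/

/-- **Handover witness** for a gauge group `G` — a `Type`-valued record of DATA, not an obligation node: a
faithful unitary representation, couplings `β_k → ∞`, positive rates `μ₁ k, μ₂ k`, volumes `L_k` and two-scale
presentations `H k S` of `μ_{Λ_{2S+1}, β_k}` such that every pair of gauge-invariant local observables satisfies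
(H1) fluctuation clustering and (H2) effective clustering, uniformly in `S ≥ L_k` and `n ≤ S`. The existence of a
witness for every compact simple Lie group is a REFORMULATION of the lattice core `WeakCouplingLatticeGap`
(`SoloInformedAnatomy`), see `handoverWitness_iff_weakCouplingLatticeGap`; no new conjecture is registered. The
seat's reduction P3 (PLAN.md §4) is the claim that Bałaban's block-average presentation after `n(β_k)`
renormalisation steps is such a witness: (H1) by ultraviolet stability (asymptotic freedom; Bałaban, Commun. Math.
Phys. 109 (1987) 249, Thms. 1–2 p. 259, and 122 (1989) 355, Thm. 1), (H2) by volume-uniform clustering of a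
`β`-independent class of effective unit-lattice actions (open; Bałaban–Imbrie–Jaffe, Commun. Math. Phys. 114 (1988)
257, pp. 257–259) — neither of which is formalised here. -/
structure HandoverWitness (G : Type) [Group G] [MeasurableSpace G] [TopologicalSpace G] [IsTopologicalGroup G]
    [CompactSpace G] [BorelSpace G] where
  /-- the lattice representation defining the Wilson action -/
  r : LatticeRep G
  β : ℕ → ℝ
  μ₁ : ℕ → ℝ
  μ₂ : ℕ → ℝ
  L : ℕ → ℕ
  /-- the two-scale presentations of `μ_{Λ_{2S+1}, β_k}` -/
  H : ∀ k S : ℕ, Handover r.ρ (β k) (2 * S + 1)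
  tendsto_β : Tendsto β atTop atTop
  μ₁_pos : ∀ k, 0 < μ₁ k
  μ₂_pos : ∀ k, 0 < μ₂ k
  /-- (H1): clustering of the conditional fine-scale laws, on `ν`-average -/
  fluctuation : ∀ A B : YMSpecies G, ∃ C₁ : ℝ, ∀ᶠ k in atTop, ∀ S : ℕ, L k ≤ S → ∀ n : ℕ, n ≤ S →
    (∫ y, |connCorr ((H k S).κ y) (torusObs (2 * S + 1) A) (torusObsShift (2 * S + 1) B n)| ∂(H k S).ν) ≤
      C₁ * Real.exp (-(μ₁ k * n))
  /-- (H2): clustering of the coarse law for the block observables -/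
  effective : ∀ A B : YMSpecies G, ∃ C₂ : ℝ, ∀ᶠ k in atTop, ∀ S : ℕ, L k ≤ S → ∀ n : ℕ, n ≤ S →
    |connCorr (H k S).ν (blockObs (H k S).κ (torusObs (2 * S + 1) A))
        (blockObs (H k S).κ (torusObsShift (2 * S + 1) B n))| ≤ C₂ * Real.exp (-(μ₂ k * n))

/-- **The handover split is exactly the lattice core.** `→`: `latticeClustering_of_handover` (rate
`min (μ₁ k) (μ₂ k)`). `←`: the trivial presentation (`Handover.trivial`; term (H2) vanishes, (H1) is the
clustering clause itself). So (H1)/(H2) locate — but do not by themselves lighten — the two jobs; all content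
of a proof along these lines is in the choice of presentation. -/
theorem handoverWitness_iff_weakCouplingLatticeGap :
    (∀ (G : Type) [Group G] [TopologicalSpace G] [IsTopologicalGroup G] [CompactSpace G],
      IsCompactSimpleLieGroup G →
        letI : MeasurableSpace G := borel G
        haveI : BorelSpace G := ⟨rfl⟩
        Nonempty (HandoverWitness G)) ↔ WeakCouplingLatticeGap := by
  constructor
  · intro h G _ _ _ _ hG
    letI : MeasurableSpace G := borel G
    haveI : BorelSpace G := ⟨rfl⟩
    obtain ⟨W⟩ := h G hG
    refine ⟨W.r, W.β, fun k => min (W.μ₁ k) (W.μ₂ k), W.L, W.tendsto_β,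
      fun k => lt_min (W.μ₁_pos k) (W.μ₂_pos k), fun A B => ?_⟩
    exact latticeClustering_of_handover W.H W.L W.μ₁ W.μ₂ A B (W.fluctuation A B) (W.effective A B)
  · intro h G _ _ _ _ hG
    letI : MeasurableSpace G := borel G
    haveI : BorelSpace G := ⟨rfl⟩
    obtain ⟨r, β, μ, L, hβ, hμ, hAB⟩ := h G hG
    refine ⟨⟨r, β, μ, μ, L, fun k S => Handover.trivial r.ρ r.continuous (β k) (2 * S + 1), hβ, hμ, hμ,
      fun A B => ?_, fun A B => ?_⟩⟩
    · obtain ⟨C, hC⟩ := hAB A B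
      refine ⟨C, ?_⟩
      filter_upwards [hC] with k hk S hS n hn
      have h1 := hk S hS n hn
      rw [latticeConnectedCorr_eq_connCorr] at h1
      rwa [Handover.trivial_fluctuation]
    · obtain ⟨C, hC⟩ := hAB A B
      refine ⟨0, ?_⟩
      filter_upwards [hC] with k hk S hS n hn
      rw [Handover.trivial_effective]
      simp

/-- **Audit root of this file.** A solo seat's file carries no route items, so its proved content is exposed to the
obligation-graph audit (D-0027, `#h21_file_audit`) as ONE proved proposition with the kernel-closed witness
`HandoverReduction_holds` (class `proved-helper` — the same device as `AnatomyEquivalence` in `SoloInformedAnatomy`;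
without such a root every declaration of an item-free file is `tree.orphan`). It is an `abbrev` and its only
consumer is that audit cone; no downstream file is expected to use the name (review of p176426, item 3). It reads:
a handover witness exists for every compact simple Lie group iff the lattice core holds. -/
abbrev HandoverReduction : Prop :=
  (∀ (G : Type) [Group G] [TopologicalSpace G] [IsTopologicalGroup G] [CompactSpace G],
      IsCompactSimpleLieGroup G →
        letI : MeasurableSpace G := borel G
        haveI : BorelSpace G := ⟨rfl⟩
        Nonempty (HandoverWitness G)) ↔ WeakCouplingLatticeGap

/-- `HandoverReduction` holds: it is `handoverWitness_iff_weakCouplingLatticeGap`. -/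
theorem HandoverReduction_holds : HandoverReduction := handoverWitness_iff_weakCouplingLatticeGap

end Summit.QuantumFields.YangMills.Theorems

end
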